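import Literature.Geometry.Lorentzian.KerrConvergenceProofs
import Literature.Geometry.Lorentzian.MultiCentreKerrSchild
import Mathlib.Analysis.Calculus.ContDiff.Bounds

/-!
# Route EIHFluxBalance — `InertialRecession`: calculus for the modulated Kerr–Schild term (part 1)

Helper file for the crux `stmt-FinalStateConjecture-10166`
(`Summit.FinalStateConjecture.FinalStateConjecture.Theses.EIHFluxBalance.InertialRecession`).

The reference bilinear-form field of the crux's modulated ansatz is
`η + Σᵢ (boostedKerrBilin (Λᵢ(x⁰)) (x⁰, ξᵢ(x⁰)) Mᵢ aᵢ x − η)`: each summand is the Kerr–Schild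
perturbation `g_{M,a} − η` seen in a frame `Θ(x⁰) = Λ(x⁰)⁻¹` and about a centre `c(x⁰)` that
both depend on LAB TIME. Every re-charting of the crux (flat chart on hole-following domains, hole
charts) needs the `Cᵐ` size of such a summand far from its centre, where derivatives may fall on
the motion `(Θ, c)` as well as on the point. This file proves the generic decay estimate

  `‖Dᵐ [y ↦ (g_{M,a}(Θ(y⁰)(y − c(y⁰))) − η)(Θ(y⁰)·, Θ(y⁰)·)] (x)‖ ≤ C(M, a, m, Γ) / d`

(`exists_norm_iteratedFDeriv_ksPert_frame_le`) whenever the frame and centre paths are `Cᵐ` with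
`‖Θ^{(k)}(x⁰)‖ ≤ Γ` (`k ≤ m`), `‖c^{(k)}(x⁰)‖ ≤ Γ` (`1 ≤ k ≤ m`), the point is at lab distance
`‖x − c(x⁰)‖ ≤ d` and rest-frame spatial radius `‖(Θ(x⁰)(x − c(x⁰)))~‖ ≥ d ≥ max 1 (2|a|)`.
The constant does NOT require the motion to converge — only pointwise bounds on `m` derivatives —
which is what the re-charting after painting rigidity / re-modulation supplies.

Proof: SCALING, as in `Kerr.norm_iteratedFDeriv_ksPert_le`. With `ε = 1/d`,
`g_{M,a} − η = εM (g_{1,εa} − η) ∘ (ε ·)` (`Kerr.ksPert_smul`), so the rest-frame factor is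
`P = εM · K ∘ f₂` with `K = g_{1,εa} − η` smooth on `{r > 0}` and `f₂(y) = εΘ(y⁰)(y − c(y⁰))`.
At `x`, `f₂(x)` lies in the compact shell `‖z‖ ≤ Γ`, `‖z~‖ ≥ 1` on which all derivatives of
`K` of order `≤ m` are bounded by `B(m, Γ)` uniformly in `|εa| ≤ 1/2`
(`exists_bound_iteratedFDeriv_ksPert_shell`), while `‖Dʲ f₂(x)‖ ≤ Dʲ` with `D = 2ᵐ Γ (2 + Γ)`
because every factor `‖x − c‖ ≤ d` produced by a derivative falling on `Θ` comes with the factor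
`ε = 1/d`; Mathlib's Faà di Bruno bound `norm_iteratedFDerivWithin_comp_le` gives
`‖Dᵏ P(x)‖ ≤ ε|M| m! B Dᵐ`. The frame factors `Θ(y⁰)v`, `Θ(y⁰)w` are then attached to the
SCALAR functions `y ↦ P(y)(Θ(y⁰)v)(Θ(y⁰)w)` by two Leibniz bounds
(`norm_iteratedFDerivWithin_clm_apply`), and the operator norm of `Dᵐ` of the form-valued map is
recovered from its scalar evaluations (`norm_iteratedFDeriv_le_of_forall_apply₂`) — this detour
avoids bilinear maps between spaces of operators, whose normed instances Lean does not find.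
-/

noncomputable section

open Literature.Geometry.Lorentzian Set Filter Function
open scoped ContDiff Topology

namespace Summit.FinalStateConjecture.FinalStateConjecture.Theorems

/-! ### Generic calculus on `E4` -/

section Calculus

variable {F : Type*} [NormedAddCommGroup F] [NormedSpace ℝ F]

-- the operator-norm instance path on form-valued multilinear maps is slow to unify
set_option synthInstance.maxHeartbeats 200000 in
/-- **Operator norm of `Dᵐ` of a bilinear-form-valued map from its scalar evaluations**: if
`‖Dᵐ(y ↦ F(y)(v, w))(x)‖ ≤ C‖v‖‖w‖` for all `v, w`, then `‖Dᵐ F(x)‖ ≤ C` (evaluation at `(v, w)`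
is a continuous linear map and commutes with `Dᵐ`; Dieudonné 1960, (8.12.6)). [folklore] -/
theorem norm_iteratedFDeriv_le_of_forall_apply₂ {F : E4 → E4 →L[ℝ] E4 →L[ℝ] ℝ} {x : E4} {m : ℕ}
    (hF : ContDiffAt ℝ m F x) {C : ℝ} (hC : 0 ≤ C)
    (h : ∀ v w : E4, ‖iteratedFDeriv ℝ m (fun y ↦ F y v w) x‖ ≤ C * ‖v‖ * ‖w‖) :
    ‖iteratedFDeriv ℝ m F x‖ ≤ C := by
  refine ContinuousMultilinearMap.opNorm_le_bound (by positivity) fun hs ↦ ?_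
  refine ContinuousLinearMap.opNorm_le_bound₂ _ (by positivity) fun v w ↦ ?_
  set L : (E4 →L[ℝ] E4 →L[ℝ] ℝ) →L[ℝ] ℝ :=
    (ContinuousLinearMap.apply ℝ ℝ w).comp (ContinuousLinearMap.apply ℝ (E4 →L[ℝ] ℝ) v) with hL
  have hLF : (fun y ↦ F y v w) = L ∘ F := by
    funext y
    simp [hL]
  have hcomm := L.iteratedFDeriv_comp_left hF (i := m) le_rfl
  have key : (iteratedFDeriv ℝ m F x hs) v w = iteratedFDeriv ℝ m (fun y ↦ F y v w) x hs := by
    rw [hLF, hcomm]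
    simp [hL]
  rw [Real.norm_eq_abs, ← Real.norm_eq_abs, key]
  calc ‖iteratedFDeriv ℝ m (fun y ↦ F y v w) x hs‖
      ≤ ‖iteratedFDeriv ℝ m (fun y ↦ F y v w) x‖ * ∏ j, ‖hs j‖ :=
        ContinuousMultilinearMap.le_opNorm _ _
    _ ≤ (C * ‖v‖ * ‖w‖) * ∏ j, ‖hs j‖ := by gcongr; exact h v w
    _ = C * (∏ j, ‖hs j‖) * ‖v‖ * ‖w‖ := by ring

/-- **Derivatives of a function of lab time only**: for `Θ : ℝ → F`,
`‖Dⁱ(y ↦ Θ(y⁰))(x)‖ ≤ ‖Θ⁽ⁱ⁾(x⁰)‖` (chain rule with the coordinate projection `y ↦ y⁰`, of norm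
`≤ 1`). [folklore] -/
theorem norm_iteratedFDeriv_comp_time_le {Θ : ℝ → F} {n : WithTop ℕ∞} (hΘ : ContDiff ℝ n Θ)
    (x : E4) {i : ℕ} (hi : (i : WithTop ℕ∞) ≤ n) :
    ‖iteratedFDeriv ℝ i (fun y : E4 ↦ Θ (y 0)) x‖ ≤ ‖iteratedDeriv i Θ (x 0)‖ := by
  have h := (EuclideanSpace.proj (0 : Fin 4) : E4 →L[ℝ] ℝ).iteratedFDeriv_comp_right hΘ x (i := i)
    hi
  have hfun : (Θ ∘ ⇑(EuclideanSpace.proj (0 : Fin 4) : E4 →L[ℝ] ℝ)) = fun y : E4 ↦ Θ (y 0) := rfl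
  rw [hfun] at h
  rw [h]
  refine (ContinuousMultilinearMap.norm_compContinuousLinearMap_le _ _).trans ?_
  rw [norm_iteratedFDeriv_eq_norm_iteratedDeriv]
  have h1 : ∏ _j : Fin i, ‖(EuclideanSpace.proj (0 : Fin 4) : E4 →L[ℝ] ℝ)‖ ≤ 1 := by
    refine Finset.prod_le_one (fun _ _ ↦ norm_nonneg _) fun _ _ ↦ ?_
    refine ContinuousLinearMap.opNorm_le_bound _ zero_le_one fun y ↦ ?_
    rw [one_mul]
    exact PiLp.norm_apply_le y 0
  calc ‖iteratedDeriv i Θ ((EuclideanSpace.proj (0 : Fin 4) : E4 →L[ℝ] ℝ) x)‖ *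
        ∏ _j : Fin i, ‖(EuclideanSpace.proj (0 : Fin 4) : E4 →L[ℝ] ℝ)‖
      ≤ ‖iteratedDeriv i Θ (x 0)‖ * 1 := mul_le_mul_of_nonneg_left h1 (norm_nonneg _)
    _ = _ := mul_one _

-- the operator-norm instance path on operator-valued multilinear maps is slow to unify
set_option synthInstance.maxHeartbeats 200000 in
/-- **Derivatives of a time-dependent frame applied to a fixed vector**: for
`Θ : ℝ → (E4 →L E4)`, `‖Dⁱ(y ↦ Θ(y⁰)v)(x)‖ ≤ ‖v‖ ‖Θ⁽ⁱ⁾(x⁰)‖`. [folklore] -/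
theorem norm_iteratedFDeriv_frame_apply_le {Θ : ℝ → E4 →L[ℝ] E4} {n : WithTop ℕ∞}
    (hΘ : ContDiff ℝ n Θ) (v x : E4) {i : ℕ} (hi : (i : WithTop ℕ∞) ≤ n) :
    ‖iteratedFDeriv ℝ i (fun y : E4 ↦ Θ (y 0) v) x‖ ≤ ‖v‖ * ‖iteratedDeriv i Θ (x 0)‖ := by
  have hf : ContDiff ℝ n (fun y : E4 ↦ Θ (y 0)) :=
    hΘ.comp (EuclideanSpace.proj (0 : Fin 4) : E4 →L[ℝ] ℝ).contDiff
  have h1 := norm_iteratedFDeriv_clm_apply_const (f := fun y : E4 ↦ Θ (y 0)) (c := v) (x := x)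
    hf.contDiffAt hi
  exact h1.trans (mul_le_mul_of_nonneg_left (norm_iteratedFDeriv_comp_time_le hΘ x hi)
    (norm_nonneg v))

/-- The identity map of `E4` has `‖Dˡ id‖ ≤ 1` for `l ≥ 1` (`D¹ id = id`, `Dˡ id = 0` for
`l ≥ 2`). [folklore] -/
theorem norm_iteratedFDeriv_id_le (x : E4) {l : ℕ} (hl : 1 ≤ l) :
    ‖iteratedFDeriv ℝ l (fun y : E4 ↦ y) x‖ ≤ 1 := by
  obtain ⟨k, rfl⟩ := Nat.exists_eq_add_of_le' hl
  rw [← norm_iteratedFDeriv_fderiv]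
  have hfd : (fderiv ℝ fun y : E4 ↦ y) = fun _ ↦ ContinuousLinearMap.id ℝ E4 := by
    funext y
    exact fderiv_id
  rw [hfd]
  rcases Nat.eq_zero_or_pos k with hk | hk
  · subst hk
    rw [norm_iteratedFDeriv_zero]
    exact ContinuousLinearMap.norm_id_le
  · rw [iteratedFDeriv_const_of_ne (Nat.pos_iff_ne_zero.mp hk)]
    simp

/-- **Derivatives of the position relative to a moving centre**: for `c : ℝ → E4` and `l ≥ 1`,
`‖Dˡ(y ↦ y − c(y⁰))(x)‖ ≤ 1 + ‖c⁽ˡ⁾(x⁰)‖`. [folklore] -/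
theorem norm_iteratedFDeriv_sub_centre_le {c : ℝ → E4} {n : WithTop ℕ∞} (hc : ContDiff ℝ n c)
    (x : E4) {l : ℕ} (hl : 1 ≤ l) (hln : (l : WithTop ℕ∞) ≤ n) :
    ‖iteratedFDeriv ℝ l (fun y : E4 ↦ y - c (y 0)) x‖ ≤ 1 + ‖iteratedDeriv l c (x 0)‖ := by
  have hid : ContDiff ℝ n (fun y : E4 ↦ y) := contDiff_id
  have hcc : ContDiff ℝ n (fun y : E4 ↦ c (y 0)) :=
    hc.comp (EuclideanSpace.proj (0 : Fin 4) : E4 →L[ℝ] ℝ).contDiff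
  have hsub : (fun y : E4 ↦ y - c (y 0)) = (fun y : E4 ↦ y) - fun y : E4 ↦ c (y 0) := rfl
  rw [hsub, iteratedFDeriv_sub_apply (hid.of_le hln).contDiffAt (hcc.of_le hln).contDiffAt]
  refine (norm_sub_le _ _).trans (add_le_add (norm_iteratedFDeriv_id_le x hl) ?_)
  exact norm_iteratedFDeriv_comp_time_le hc x hln

/-- Binomial bookkeeping for Mathlib's Leibniz bounds: if `‖Dⁱ f‖ ≤ α` and `‖Dʲ g‖ ≤ β` for all
orders involved (all quantities nonnegative), then `Σᵢ C(n,i) ‖Dⁱ f‖ ‖Dⁿ⁻ⁱ g‖ ≤ 2ⁿ α β`. [folklore] -/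
theorem sum_choose_mul_mul_le {n : ℕ} {A B : ℕ → ℝ} {α β : ℝ} (hα : 0 ≤ α)
    (hA : ∀ i ≤ n, A i ≤ α) (hB0 : ∀ i, 0 ≤ B i) (hB : ∀ i ≤ n, B i ≤ β) :
    ∑ i ∈ Finset.range (n + 1), (n.choose i : ℝ) * A i * B (n - i) ≤ 2 ^ n * α * β := by
  calc ∑ i ∈ Finset.range (n + 1), (n.choose i : ℝ) * A i * B (n - i)
      ≤ ∑ i ∈ Finset.range (n + 1), (n.choose i : ℝ) * α * β := by
        refine Finset.sum_le_sum fun i hi ↦ ?_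
        have hin : i ≤ n := Nat.lt_succ_iff.mp (Finset.mem_range.mp hi)
        have h1 : A i * B (n - i) ≤ α * β :=
          mul_le_mul (hA i hin) (hB (n - i) (Nat.sub_le n i)) (hB0 _) hα
        have h2 : (0 : ℝ) ≤ n.choose i := Nat.cast_nonneg _
        calc (n.choose i : ℝ) * A i * B (n - i) = (n.choose i : ℝ) * (A i * B (n - i)) := by ring
          _ ≤ (n.choose i : ℝ) * (α * β) := mul_le_mul_of_nonneg_left h1 h2
          _ = (n.choose i : ℝ) * α * β := by ring
    _ = (∑ i ∈ Finset.range (n + 1), (n.choose i : ℝ)) * α * β := by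
        rw [Finset.sum_mul, Finset.sum_mul]
    _ = 2 ^ n * α * β := by
        congr 1
        congr 1
        have h := Nat.sum_range_choose n
        exact_mod_cast h

/-- `T(A·, A·) = (compL.flip A) ∘ (T ∘ A)` as continuous linear maps (bookkeeping identity used to
differentiate `(T, A) ↦ T(A·, A·)` with Mathlib's `clm_comp` rules). [folklore] -/
theorem bilinearComp_self_eq_comp (T : E4 →L[ℝ] E4 →L[ℝ] ℝ) (A : E4 →L[ℝ] E4) :
    T.bilinearComp A A =
      ((ContinuousLinearMap.compL ℝ E4 E4 ℝ).flip A).comp (T.comp A) := by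
  ext v w
  simp

/-- `y ↦ T(y)(A(y)·, A(y)·)` is `Cⁿ` along `Cⁿ` maps `T`, `A` (it is polynomial in `(T, A)`).
[folklore] -/
theorem contDiffWithinAt_bilinearComp_self {X : Type*} [NormedAddCommGroup X] [NormedSpace ℝ X]
    {n : WithTop ℕ∞} {T : X → E4 →L[ℝ] E4 →L[ℝ] ℝ} {A : X → E4 →L[ℝ] E4} {s : Set X} {x : X}
    (hT : ContDiffWithinAt ℝ n T s x) (hA : ContDiffWithinAt ℝ n A s x) :
    ContDiffWithinAt ℝ n (fun y ↦ (T y).bilinearComp (A y) (A y)) s x := by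
  have h1 : ContDiffWithinAt ℝ n (fun y ↦ (T y).comp (A y)) s x := hT.clm_comp hA
  have h2 := ContDiffWithinAt.continuousLinearMap_comp (G := (E4 →L[ℝ] ℝ) →L[ℝ] (E4 →L[ℝ] ℝ))
    ((ContinuousLinearMap.compL ℝ E4 E4 ℝ).flip) hA
  have h3 := h2.clm_comp h1
  have hfun : (fun y ↦ (T y).bilinearComp (A y) (A y)) =
      fun y ↦ ((ContinuousLinearMap.compL ℝ E4 E4 ℝ).flip (A y)).comp ((T y).comp (A y)) :=
    funext fun y ↦ bilinearComp_self_eq_comp (T y) (A y)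
  rw [hfun]
  exact h3

end Calculus

/-! ### The Kerr–Schild perturbation on a compact rest-frame shell -/

/-- **Uniform bound on a thick shell, uniformly in small spin.** For every order `m` and size `Γ`
there is `B ≥ 0` with `‖Dʲ (g_{1,a'} − η)(z)‖ ≤ B` for all `j ≤ m`, `|a'| ≤ 1/2`, `‖z‖ ≤ Γ`,
`‖z~‖ ≥ 1` (continuity of `Dʲ` of the jointly smooth perturbation `Kerr.contDiffAt_ksPert₂` on a
compact subset of `{r > 0}`). Kerr–Schild 1965, §3. [cite: KerrSchild1965, §3] -/
theorem exists_bound_iteratedFDeriv_ksPert_shell' (m : ℕ) (Γ : ℝ) :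
    ∃ B : ℝ, 0 ≤ B ∧ ∀ j ≤ m, ∀ (a' : ℝ) (z : E4), |a'| ≤ 1 / 2 → ‖z‖ ≤ Γ →
      1 ≤ E4.spatialNorm z →
      ‖iteratedFDeriv ℝ j (fun y ↦ Kerr.bilin 1 a' y - Minkowski.bilin) z‖ ≤ B := by
  set O : Set (ℝ × E4) := {p | 0 < Kerr.radius p.1 p.2} with hO
  have hOo : IsOpen O := by
    refine isOpen_lt continuous_const ?_
    unfold Kerr.radius E4.spatialNorm
    fun_prop
  have hcd : ContDiffOn ℝ ∞ (fun q : ℝ × E4 ↦ Kerr.bilin 1 q.1 q.2 - Minkowski.bilin) O :=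
    fun p hp ↦ (Kerr.contDiffAt_ksPert₂ hp).contDiffWithinAt
  set K : Set (ℝ × E4) :=
    Icc (-(1 / 2 : ℝ)) (1 / 2) ×ˢ (Metric.closedBall (0 : E4) Γ ∩ {z : E4 | 1 ≤ E4.spatialNorm z})
    with hK
  have hsn : Continuous E4.spatialNorm := continuous_norm.comp E4.spatial.continuous
  have hKc : IsCompact K := by
    refine isCompact_Icc.prod ?_
    exact (isCompact_closedBall _ _).inter_right (isClosed_le continuous_const hsn)
  have hKO : K ⊆ O := by
    rintro ⟨a', z⟩ ⟨ha', -, hz⟩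
    change 0 < Kerr.radius a' z
    apply Kerr.radius_pos_of_abs_lt
    have : |a'| ≤ 1 / 2 := abs_le.mpr ⟨ha'.1, ha'.2⟩
    change 1 ≤ E4.spatialNorm z at hz
    linarith
  have hbound : ∀ j : ℕ, ∃ C : ℝ, ∀ q ∈ K,
      ‖iteratedFDeriv ℝ j (fun q : ℝ × E4 ↦ Kerr.bilin 1 q.1 q.2 - Minkowski.bilin) q‖ ≤ C := by
    intro j
    have hcont : ContinuousOn
        (iteratedFDeriv ℝ j (fun q : ℝ × E4 ↦ Kerr.bilin 1 q.1 q.2 - Minkowski.bilin)) O := by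
      have h1 := hcd.continuousOn_iteratedFDerivWithin (m := j) (by exact_mod_cast le_top)
        hOo.uniqueDiffOn
      exact h1.congr fun p hp ↦ (iteratedFDerivWithin_of_isOpen j hOo hp).symm
    obtain ⟨C, hC⟩ := hKc.exists_bound_of_continuousOn (hcont.mono hKO)
    exact ⟨C, hC⟩
  choose C hC using hbound
  refine ⟨∑ j ∈ Finset.range (m + 1), |C j|, Finset.sum_nonneg fun _ _ ↦ abs_nonneg _,
    fun j hj a' z ha' hz hz1 ↦ ?_⟩
  have hmem : (a', z) ∈ K := by
    refine ⟨⟨by linarith [(abs_le.mp ha').1], (abs_le.mp ha').2⟩, ?_, hz1⟩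
    simpa using hz
  have hslice := Kerr.norm_iteratedFDeriv_slice_le hOo hcd (hKO hmem) (i := j)
    (by exact_mod_cast le_top)
  have h1 := (hslice.trans (hC j _ hmem)).trans (le_abs_self (C j))
  have h2 : |C j| ≤ ∑ k ∈ Finset.range (m + 1), |C k| :=
    Finset.single_le_sum (f := fun k ↦ |C k|) (fun _ _ ↦ abs_nonneg _)
      (Finset.mem_range.mpr (Nat.lt_succ_of_le hj))
  exact h1.trans h2

/-- Registered sub-goal form (stub `exists_bound_iteratedFDeriv_ksPert_shell` of the crux item) of
`exists_bound_iteratedFDeriv_ksPert_shell'`: uniform bound on all derivatives of `g_{1,a'} − η` of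
order `≤ m` on the thick shell, uniformly in `|a'| ≤ 1/2`. Kerr–Schild 1965, §3. [cite: KerrSchild1965, §3] -/
theorem exists_bound_iteratedFDeriv_ksPert_shell : open Literature.Geometry.Lorentzian in ∀ (m : ℕ) (Γ : ℝ), ∃ B : ℝ, 0 ≤ B ∧ ∀ j ≤ m, ∀ (a' : ℝ) (z : E4), |a'| ≤ 1 / 2 → ‖z‖ ≤ Γ → 1 ≤ E4.spatialNorm z → ‖iteratedFDeriv ℝ j (fun y ↦ Kerr.bilin 1 a' y - Minkowski.bilin) z‖ ≤ B :=
  exists_bound_iteratedFDeriv_ksPert_shell'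

end Summit.FinalStateConjecture.FinalStateConjecture.Theorems

end
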